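import Summits.AtomisticToContinuum.Crystallization.Theorems.FrustratedLawDichotomyStrainedPatchHomCurvNear

/-!
# `boxLabels7` has no duplicates (so the in-kernel label lists `nearLabels …` and their filters are `Nodup`)

decomp-a2c hand-1 g27 (crux `AperiodicFrustratedLawGap`, stmt-AtomisticToContinuum-27623; `(H) HomFloor (1/625)`, hcp half; lever (C)).  The
soundness theorems of the curvature leaves (`curv_floor_of_curvCheck2`, `curv_floor_of_curvCheckL(2)`) take `L.Nodup` for the label lists; the
production lists are kernel filters of `…HomCurvLeaf.boxLabels7` (`nearLabels`, and the centred/naive split).  `decide` cannot see through `3375`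
vector labels (hand-1 g26), so `Nodup` is proved structurally: nested `List.nodup_flatMap` over `rng15` with disjointness read off one coordinate.
★ `boxLabels7_nodup`, `nearLabels_nodup`, `nodup_filter_append` (a filter and its complement filter, appended, stay `Nodup`).

NO definitions; 0 sorry; standard axioms; no instances / notation / `#eval`.  `--supports stmt-AtomisticToContinuum-27623`.
-/

namespace Summit.AtomisticToContinuum.Crystallization.Theorems.FrustratedLawDichotomyStrainedPatchHomCurvLeaf

/-- `rng15` has no duplicates. [formal bookkeeping] -/
theorem rng15_nodup : rng15.Nodup := by decide

/-- `k ↦ ![i, j, k]` images over `rng15` have no duplicates. [formal bookkeeping] -/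
theorem nodup_map_third (i j : ℤ) : (rng15.map fun k => (![i, j, k] : Fin 3 → ℤ)).Nodup := by
  refine rng15_nodup.map fun k k' h => ?_
  have := congrFun h 2
  simpa using this

/-- ★ `boxLabels7.Nodup`. [formal bookkeeping] -/
theorem boxLabels7_nodup : boxLabels7.Nodup := by
  unfold boxLabels7
  rw [List.nodup_flatMap]
  refine ⟨fun i _ => ?_, ?_⟩
  · rw [List.nodup_flatMap]
    refine ⟨fun j _ => nodup_map_third i j, ?_⟩
    refine rng15_nodup.pairwise_of_forall_ne fun j _ j' _ hne => ?_
    intro x hx hx'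
    obtain ⟨k, _, rfl⟩ := List.mem_map.1 hx
    obtain ⟨k', _, h⟩ := List.mem_map.1 hx'
    have := congrFun h 1
    simp at this
    exact hne this.symm
  · refine rng15_nodup.pairwise_of_forall_ne fun i _ i' _ hne => ?_
    intro x hx hx'
    obtain ⟨j, _, hx⟩ := List.mem_flatMap.1 hx
    obtain ⟨k, _, rfl⟩ := List.mem_map.1 hx
    obtain ⟨j', _, hx'⟩ := List.mem_flatMap.1 hx'
    obtain ⟨k', _, h⟩ := List.mem_map.1 hx'
    have := congrFun h 0
    simp at this
    exact hne this.symm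

/-- ★ `(nearLabels c w r2n r2d).Nodup`. [formal bookkeeping] -/
theorem nearLabels_nodup (c w : (Fin 3 × Fin 3) ⊕ Fin 3 → ℤ) (r2n : ℤ) (r2d : ℕ) : (nearLabels c w r2n r2d).Nodup := by
  unfold nearLabels
  exact boxLabels7_nodup.filter _

/-- Every near label is a box label. [formal bookkeeping] -/
theorem mem_boxLabels7_of_mem_nearLabels {c w : (Fin 3 × Fin 3) ⊕ Fin 3 → ℤ} {r2n : ℤ} {r2d : ℕ} {b : Fin 3 → ℤ}
    (h : b ∈ nearLabels c w r2n r2d) : b ∈ boxLabels7 := (List.mem_filter.1 h).1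

/-- ★ A filter and its complementary filter of a duplicate-free list, appended, are duplicate-free (the centred ++ naive split of the leaf). [folklore] -/
theorem nodup_filter_append {α : Type*} {l : List α} (hl : l.Nodup) (p : α → Bool) :
    (l.filter p ++ l.filter fun a => !p a).Nodup := by
  rw [List.nodup_append]
  refine ⟨hl.filter _, hl.filter _, ?_⟩
  intro a ha b hb hab
  subst hab
  have h1 := (List.mem_filter.1 ha).2
  have h2 := (List.mem_filter.1 hb).2
  simp [h1] at h2

end Summit.AtomisticToContinuum.Crystallization.Theorems.FrustratedLawDichotomyStrainedPatchHomCurvLeaf
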